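import Literature.Computability.FineGrained.IPRenameBTable
import HarnessLib

/-!
# The renaming machine of Impagliazzo–Paturi's Lemma 2, XVI: the odometer over the f-vectors

Family `fine-grained` (trunk T-CPLX-FINE). Sixteenth file of the machine half of Impagliazzo–Paturi's Lemma 2. `IPRename.reduceList`
ranges, for each mask, over all `f`-vectors dominated by the sizes of the nonempty blocks
(`reduceList_eq_numNB`, `IPRename.fvecs`). The machine keeps the vector as unary digits (`dW`),
last block first, and steps it like an odometer.

* Functional: `odoM` (number of vectors), `odoAt ss t` (the `t`-th vector, least significant digit
  first), `succD` (one increment with overflow flag), **`succD_odoAt`** / `succD_last` (the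
  increment steps through `odoAt` and overflows exactly at the last vector),
  `fvecs_append_singleton`, **`map_odoAt_reverse`**: read in block order the visited vectors are
  `fvecs` of the block-order sizes, in order;
* Machine: `readD` (a bounded unary digit; the bound `m` is baked into the program), `fvBody` /
  `fvStep m` and **`runs_fvStep`**: `fv := dW (succD ds ss).1`, flag `ju := (succD ds ss).2`.

## References

* R. Impagliazzo, R. Paturi, *On the complexity of k-SAT*, J. Comput. System Sci. 62 (2001)
  367–375, doi:10.1006/jcss.2000.1727, Lemma 2 (p. 373) and its "Moreover" sentence (the
  reduction is computable within the stated time); pp. 371–372 (`G_x`, `Ψ`, `Θ_i`, `Φ_f`).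
  (Not held; acquisition request acq-00143.)
* T. Nipkow, G. Klein, *Concrete Semantics with Isabelle/HOL*, Springer 2014, Ch. 7 (big-step
  reasoning about loops, as in `SymbolPrograms.lean`).
-/

namespace Literature.Computability.FineGrained.IPRenameM

open _root_.Computability Complexity Complexity.ACom Sparsifier IPRename
open Compaction (uflag uflag_true uflag_false)

/-! ### The odometer over the `f`-vectors: functional description

The machine keeps the `f`-vector as unary digits, the digit of the LAST block first (at the top
of the stack), and increments the first digit fastest. With the sizes `ss` in the same order,
the `t`-th vector visited is `odoAt ss t` (mixed radix, least significant digit first), there are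
`odoM ss = ∏ (s + 1)` of them, and read in block order they are exactly `IPRename.fvecs` of the
block-order sizes. -/

/-- The number of vectors dominated by `ss`. [folklore] -/
def odoM : List ℕ → ℕ
  | [] => 1
  | s :: ss => (s + 1) * odoM ss

/-- The `t`-th vector of the odometer (least significant digit first). [folklore] -/
def odoAt : List ℕ → ℕ → List ℕ
  | [], _ => []
  | s :: ss, t => (t % (s + 1)) :: odoAt ss (t / (s + 1))

/-- One increment of the odometer: the new digits and whether it overflowed. [folklore] -/
def succD : List ℕ → List ℕ → List ℕ × Bool
  | d :: ds, s :: ss => if d < s then ((d + 1) :: ds, false) else ((0 :: (succD ds ss).1), (succD ds ss).2)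
  | _, _ => ([], true)

/-- `odoM` is positive. [folklore] -/
theorem odoM_pos : ∀ ss : List ℕ, 0 < odoM ss
  | [] => Nat.one_pos
  | s :: ss => Nat.mul_pos (Nat.succ_pos s) (odoM_pos ss)

/-- The first vector is all zeros. [folklore] -/
theorem odoAt_zero : ∀ ss : List ℕ, odoAt ss 0 = List.replicate ss.length 0
  | [] => rfl
  | _ :: ss => by rw [odoAt, Nat.zero_mod, Nat.zero_div, odoAt_zero ss]; rfl

/-- The last vector is the sizes. [folklore] -/
theorem odoAt_last : ∀ ss : List ℕ, odoAt ss (odoM ss - 1) = ss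
  | [] => rfl
  | s :: ss => by
    have hM := odoM_pos ss
    rw [odoAt, odoM]
    have e : (s + 1) * odoM ss - 1 = s + (odoM ss - 1) * (s + 1) := by
      rw [Nat.mul_comm]
      rcases h : odoM ss with _ | M; · omega
      · simp [Nat.succ_mul]; omega
    rw [e, Nat.add_mul_mod_self_right, Nat.mod_eq_of_lt (Nat.lt_succ_self s), Nat.add_mul_div_right _ _ (Nat.succ_pos s),
      Nat.div_eq_of_lt (Nat.lt_succ_self s), Nat.zero_add, odoAt_last ss]

/-- The digits are dominated by the sizes. [folklore] -/
theorem odoAt_le : ∀ (ss : List ℕ) (t : ℕ), List.Forall₂ (· ≤ ·) (odoAt ss t) ss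
  | [], _ => List.Forall₂.nil
  | s :: ss, t => List.Forall₂.cons (Nat.le_of_lt_succ (Nat.mod_lt t (Nat.succ_pos s))) (odoAt_le ss _)

/-- **The increment steps through the odometer.** [folklore] -/
theorem succD_odoAt : ∀ (ss : List ℕ) (t : ℕ), t + 1 < odoM ss → succD (odoAt ss t) ss = (odoAt ss (t + 1), false)
  | [], _, h => by simp [odoM] at h
  | s :: ss, t, h => by
    rw [odoAt, odoAt, succD]
    have hs := Nat.succ_pos s
    have hxlt : t % (s + 1) < s + 1 := Nat.mod_lt t hs
    generalize hx : t % (s + 1) = x at hxlt ⊢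
    by_cases hlt : x < s
    · rw [if_pos hlt]
      have h1 : (t + 1) % (s + 1) = x + 1 := by rw [succ_mod_eq' t _ hs, hx, if_neg (by omega)]
      have h2 : (t + 1) / (s + 1) = t / (s + 1) := by
        rw [Nat.succ_div, if_neg ?_]; · rfl
        intro hd; have := Nat.mod_eq_zero_of_dvd hd; rw [h1] at this; omega
      rw [h1, h2]
    · rw [if_neg hlt]
      have hmax : x = s := by omega
      have h1 : (t + 1) % (s + 1) = 0 := by rw [succ_mod_eq' t _ hs, hx, if_pos (by omega)]
      have hdvd : (s + 1) ∣ t + 1 := Nat.dvd_of_mod_eq_zero h1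
      have h2 : (t + 1) / (s + 1) = t / (s + 1) + 1 := by rw [Nat.succ_div, if_pos hdvd]
      have h3 : t / (s + 1) + 1 < odoM ss := by
        rw [odoM] at h
        have := (Nat.div_lt_iff_lt_mul hs).2 (by rw [Nat.mul_comm]; exact h)
        rw [← h2]; exact this
      rw [succD_odoAt ss _ h3, h1, h2]

/-- **The increment of the last vector overflows.** [folklore] -/
theorem succD_last : ∀ (ss : List ℕ), (succD ss ss).2 = true
  | [] => rfl
  | s :: ss => by rw [succD, if_neg (lt_irrefl s)]; exact succD_last ss

/-- `fvecs` of an append. [folklore] -/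
theorem fvecs_append_singleton : ∀ (L : List ℕ) (s : ℕ),
    fvecs (L ++ [s]) = (fvecs L).flatMap fun v => (List.range (s + 1)).map fun d => v ++ [d]
  | [], s => by
    simp only [List.nil_append, fvecs, List.map_cons, List.map_nil, List.flatMap_cons, List.flatMap_nil, List.append_nil]
    induction List.range (s + 1) with
    | nil => rfl
    | cons d l ih => simp [ih]
  | a :: L, s => by
    rw [List.cons_append, fvecs, fvecs, fvecs_append_singleton L s]
    simp only [List.flatMap_map, List.map_flatMap, List.flatMap_assoc, List.map_map]
    rfl

/-- `range (b a)` in blocks of `a`. [folklore] -/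
theorem range_mul_eq_flatMap (a : ℕ) : ∀ b : ℕ, List.range (b * a) = (List.range b).flatMap fun j => (List.range a).map fun i => j * a + i
  | 0 => by simp
  | b + 1 => by
    rw [Nat.succ_mul, List.range_add, range_mul_eq_flatMap a b, List.range_succ, List.flatMap_append, List.flatMap_singleton]

/-- **The odometer enumerates `fvecs`** (of the block-order sizes, in order). [folklore] -/
theorem map_odoAt_reverse : ∀ ss : List ℕ, ((List.range (odoM ss)).map fun t => (odoAt ss t).reverse) = fvecs ss.reverse
  | [] => by simp [odoM, odoAt, fvecs]
  | s :: ss => by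
    rw [odoM, Nat.mul_comm, range_mul_eq_flatMap, List.map_flatMap, List.reverse_cons, fvecs_append_singleton, ← map_odoAt_reverse ss,
      List.flatMap_map]
    refine List.flatMap_congr fun j _ => ?_
    rw [List.map_map]
    refine List.map_congr_left fun i hi => ?_
    have hi' : i < s + 1 := List.mem_range.1 hi
    simp only [Function.comp_apply, odoAt, List.reverse_cons]
    have e1 : (j * (s + 1) + i) % (s + 1) = i := by rw [Nat.mul_add_mod', Nat.mod_eq_of_lt hi']
    have e2 : (j * (s + 1) + i) / (s + 1) = j := by rw [Nat.add_comm, Nat.add_mul_div_right _ _ (Nat.succ_pos s), Nat.div_eq_of_lt hi', Nat.zero_add]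
    rw [e1, e2]

/-- `odoM` is a product, hence that of the reversed list too. [folklore] -/
theorem odoM_eq_prod : ∀ ss : List ℕ, odoM ss = (ss.map (· + 1)).prod
  | [] => rfl
  | s :: ss => by rw [odoM, odoM_eq_prod ss]; simp

/-- The number of vectors is `|fvecs|`. [folklore] -/
theorem length_fvecs_reverse (ss : List ℕ) : (fvecs ss.reverse).length = odoM ss := by
  rw [← map_odoAt_reverse, List.length_map, List.length_range]

/-! ### The odometer over the `f`-vectors: the machine step -/

/-- The word of a digit list: each digit in unary blanks, closed by a comma. [folklore] -/
def dW (ds : List ℕ) : List Γ' := ds.flatMap fun d => List.replicate d Γ'.blank ++ [Γ'.comma]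

/-- `dW` over a cons. [folklore] -/
theorem dW_cons (d : ℕ) (ds : List ℕ) : dW (d :: ds) = List.replicate d Γ'.blank ++ Γ'.comma :: dW ds := by simp [dW]

/-- `dW` of nothing. [folklore] -/
@[simp] theorem dW_nil : dW [] = [] := rfl

/-- The length of a digit word. [folklore] -/
theorem length_dW_cons (d : ℕ) (ds : List ℕ) : (dW (d :: ds)).length = d + 1 + (dW ds).length := by
  rw [dW_cons]; simp; omega

/-- Read one unary digit (at most `j` blanks and its comma) from `src` onto `dst`; the bound is
baked into the program. [folklore] -/
def readD (src dst : Reg) : ℕ → RProg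
  | 0 => skip
  | j + 1 => pop src fun o => match o with
      | some Γ'.blank => push dst Γ'.blank ;; readD src dst j
      | _ => skip

/-- **`readD`** on a digit `d ≤ j`. [folklore] -/
theorem runs_readD {src dst : Reg} (hsd : src ≠ dst) : ∀ (j d : ℕ), d ≤ j → ∀ (rest : List Γ') (R : RStore), R src = List.replicate d Γ'.blank ++ Γ'.comma :: rest →
    Runs (readD src dst (j + 1)) R (Function.update (Function.update R src rest) dst (List.replicate d Γ'.blank ++ R dst)) (3 * d + 2)
  | j, 0, _, rest, R, h => by
    unfold readD
    rw [List.replicate_zero, List.nil_append] at h ⊢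
    refine Runs.pop_cons (k := src) (a := Γ'.comma) (w := rest) h ((Runs.skip _).of_eq ?_ le_rfl)
    exact (Function.update_eq_self_iff.2 (by simp [hsd.symm])).symm
  | 0, d + 1, hd, _, _, _ => absurd hd (by omega)
  | j + 1, d + 1, hd, rest, R, h => by
    unfold readD
    rw [List.replicate_succ, List.cons_append] at h
    refine (Runs.pop_cons (k := src) (a := Γ'.blank) (w := List.replicate d Γ'.blank ++ Γ'.comma :: rest) h ?_).mono (show (1 + (3 * d + 2)) + 2 ≤ _ by omega)
    have hp : Runs (push dst Γ'.blank) (Function.update R src (List.replicate d Γ'.blank ++ Γ'.comma :: rest))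
        (Function.update (Function.update R src (List.replicate d Γ'.blank ++ Γ'.comma :: rest)) dst (Γ'.blank :: R dst)) 1 := Runs.push' (by simp [hsd.symm])
    have ih := runs_readD hsd j d (by omega) rest (Function.update (Function.update R src (List.replicate d Γ'.blank ++ Γ'.comma :: rest)) dst (Γ'.blank :: R dst))
      (by simp [hsd])
    refine (hp.seq ih).of_eq ?_ le_rfl
    funext q
    by_cases q1 : q = dst; · subst q1; simp [List.replicate_succ']
    by_cases q2 : q = src; · subst q2; simp [hsd]
    simp [q1, q2]

/-- Body of the odometer step: one digit of `fv` against one digit of the sizes copy `szs2`.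
[folklore] -/
def fvBody (m : ℕ) : RProg :=
  readD (kr KR.fv) (kr KR.u1) (m + 1) ;; readD (kr KR.szs2) (kr KR.u2) (m + 1) ;; copyToG (kr KR.u1) (kr KR.u3) (kr KR.t1) (kr KR.t2) ;;
  cmpU (kr KR.u1) (kr KR.u2) (kr KR.fl2) (kr KR.fl3) Γ'.blank ;; clear (kr KR.fl2) ;;
  pop (kr KR.fl3) fun o => match o with
    | some _ => (loop (kr KR.u3) fun s => push (kr KR.fv2) s) ;; push (kr KR.fv2) Γ'.blank ;; push (kr KR.fv2) Γ'.comma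
    | none => clear (kr KR.u3) ;; push (kr KR.fv2) Γ'.comma ;; ifTop (kr KR.fv) fun o' => match o' with
        | some _ => push (kr KR.fl) Γ'.blank
        | none => push (kr KR.ju) Γ'.blank

/-- **`fvStep m`**: increment the `f`-vector (unary digits in `fv`, dominated by the digits in
`szs`); raise `ju` when it wrapped around. [folklore] -/
def fvStep (m : ℕ) : RProg :=
  ifTop (kr KR.fv) fun o => match o with
    | none => push (kr KR.ju) Γ'.blank
    | some _ => copyToG (kr KR.szs) (kr KR.szs2) (kr KR.t1) (kr KR.t2) ;; push (kr KR.fl) Γ'.blank ;; whileLoop (kr KR.fl) (fvBody m) ;;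
        pour (kr KR.fv2) (kr KR.fv) ;; clear (kr KR.szs2)

/-- The store family `vSt` over a base store. [folklore] -/
def vSt (S : RStore) (fv szs2 u1 u2 u3 fl2 fl3 fv2 fl ju : List Γ') : RStore := fun r =>
  if r = kr KR.fv then fv else if r = kr KR.szs2 then szs2 else if r = kr KR.u1 then u1 else if r = kr KR.u2 then u2 else if r = kr KR.u3 then u3 else if r = kr KR.fl2 then fl2 else if r = kr KR.fl3 then fl3 else if r = kr KR.fv2 then fv2 else if r = kr KR.fl then fl else if r = kr KR.ju then ju else S r

section VstLemmas

variable (S : RStore) (fv szs2 u1 u2 u3 fl2 fl3 fv2 fl ju w : List Γ')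

/-- Reading `fv`. [folklore] -/
@[simp] theorem vSt_fv : vSt S fv szs2 u1 u2 u3 fl2 fl3 fv2 fl ju (kr KR.fv) = fv := by simp [vSt]
/-- Reading `szs2`. [folklore] -/
@[simp] theorem vSt_szs2 : vSt S fv szs2 u1 u2 u3 fl2 fl3 fv2 fl ju (kr KR.szs2) = szs2 := by simp [vSt]
/-- Reading `u1`. [folklore] -/
@[simp] theorem vSt_u1 : vSt S fv szs2 u1 u2 u3 fl2 fl3 fv2 fl ju (kr KR.u1) = u1 := by simp [vSt]
/-- Reading `u2`. [folklore] -/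
@[simp] theorem vSt_u2 : vSt S fv szs2 u1 u2 u3 fl2 fl3 fv2 fl ju (kr KR.u2) = u2 := by simp [vSt]
/-- Reading `u3`. [folklore] -/
@[simp] theorem vSt_u3 : vSt S fv szs2 u1 u2 u3 fl2 fl3 fv2 fl ju (kr KR.u3) = u3 := by simp [vSt]
/-- Reading `fl2`. [folklore] -/
@[simp] theorem vSt_fl2 : vSt S fv szs2 u1 u2 u3 fl2 fl3 fv2 fl ju (kr KR.fl2) = fl2 := by simp [vSt]
/-- Reading `fl3`. [folklore] -/
@[simp] theorem vSt_fl3 : vSt S fv szs2 u1 u2 u3 fl2 fl3 fv2 fl ju (kr KR.fl3) = fl3 := by simp [vSt]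
/-- Reading `fv2`. [folklore] -/
@[simp] theorem vSt_fv2 : vSt S fv szs2 u1 u2 u3 fl2 fl3 fv2 fl ju (kr KR.fv2) = fv2 := by simp [vSt]
/-- Reading `fl`. [folklore] -/
@[simp] theorem vSt_fl : vSt S fv szs2 u1 u2 u3 fl2 fl3 fv2 fl ju (kr KR.fl) = fl := by simp [vSt]
/-- Reading `ju`. [folklore] -/
@[simp] theorem vSt_ju : vSt S fv szs2 u1 u2 u3 fl2 fl3 fv2 fl ju (kr KR.ju) = ju := by simp [vSt]
/-- Reading any other register. [folklore] -/
theorem vSt_other {r : Reg} (h0 : r ≠ kr KR.fv) (h1 : r ≠ kr KR.szs2) (h2 : r ≠ kr KR.u1) (h3 : r ≠ kr KR.u2) (h4 : r ≠ kr KR.u3) (h5 : r ≠ kr KR.fl2) (h6 : r ≠ kr KR.fl3) (h7 : r ≠ kr KR.fv2) (h8 : r ≠ kr KR.fl) (h9 : r ≠ kr KR.ju) :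
    vSt S fv szs2 u1 u2 u3 fl2 fl3 fv2 fl ju r = S r := by simp [vSt, h0, h1, h2, h3, h4, h5, h6, h7, h8, h9]
/-- Reading `szs`. [folklore] -/
@[simp] theorem vSt_szs : vSt S fv szs2 u1 u2 u3 fl2 fl3 fv2 fl ju (kr KR.szs) = S (kr KR.szs) := by simp [vSt]
/-- Reading `t1`. [folklore] -/
@[simp] theorem vSt_t1 : vSt S fv szs2 u1 u2 u3 fl2 fl3 fv2 fl ju (kr KR.t1) = S (kr KR.t1) := by simp [vSt]
/-- Reading `t2`. [folklore] -/
@[simp] theorem vSt_t2 : vSt S fv szs2 u1 u2 u3 fl2 fl3 fv2 fl ju (kr KR.t2) = S (kr KR.t2) := by simp [vSt]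
/-- Updating `fv`. [folklore] -/
@[simp] theorem update_vSt_fv : Function.update (vSt S fv szs2 u1 u2 u3 fl2 fl3 fv2 fl ju) (kr KR.fv) w = vSt S w szs2 u1 u2 u3 fl2 fl3 fv2 fl ju := by
  funext r; by_cases h : r = kr KR.fv
  · subst h; simp
  · rw [Function.update_of_ne h]; simp [vSt, h]
/-- Updating `szs2`. [folklore] -/
@[simp] theorem update_vSt_szs2 : Function.update (vSt S fv szs2 u1 u2 u3 fl2 fl3 fv2 fl ju) (kr KR.szs2) w = vSt S fv w u1 u2 u3 fl2 fl3 fv2 fl ju := by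
  funext r; by_cases h : r = kr KR.szs2
  · subst h; simp
  · rw [Function.update_of_ne h]; simp [vSt, h]
/-- Updating `u1`. [folklore] -/
@[simp] theorem update_vSt_u1 : Function.update (vSt S fv szs2 u1 u2 u3 fl2 fl3 fv2 fl ju) (kr KR.u1) w = vSt S fv szs2 w u2 u3 fl2 fl3 fv2 fl ju := by
  funext r; by_cases h : r = kr KR.u1
  · subst h; simp
  · rw [Function.update_of_ne h]; simp [vSt, h]
/-- Updating `u2`. [folklore] -/
@[simp] theorem update_vSt_u2 : Function.update (vSt S fv szs2 u1 u2 u3 fl2 fl3 fv2 fl ju) (kr KR.u2) w = vSt S fv szs2 u1 w u3 fl2 fl3 fv2 fl ju := by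
  funext r; by_cases h : r = kr KR.u2
  · subst h; simp
  · rw [Function.update_of_ne h]; simp [vSt, h]
/-- Updating `u3`. [folklore] -/
@[simp] theorem update_vSt_u3 : Function.update (vSt S fv szs2 u1 u2 u3 fl2 fl3 fv2 fl ju) (kr KR.u3) w = vSt S fv szs2 u1 u2 w fl2 fl3 fv2 fl ju := by
  funext r; by_cases h : r = kr KR.u3
  · subst h; simp
  · rw [Function.update_of_ne h]; simp [vSt, h]
/-- Updating `fl2`. [folklore] -/
@[simp] theorem update_vSt_fl2 : Function.update (vSt S fv szs2 u1 u2 u3 fl2 fl3 fv2 fl ju) (kr KR.fl2) w = vSt S fv szs2 u1 u2 u3 w fl3 fv2 fl ju := by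
  funext r; by_cases h : r = kr KR.fl2
  · subst h; simp
  · rw [Function.update_of_ne h]; simp [vSt, h]
/-- Updating `fl3`. [folklore] -/
@[simp] theorem update_vSt_fl3 : Function.update (vSt S fv szs2 u1 u2 u3 fl2 fl3 fv2 fl ju) (kr KR.fl3) w = vSt S fv szs2 u1 u2 u3 fl2 w fv2 fl ju := by
  funext r; by_cases h : r = kr KR.fl3
  · subst h; simp
  · rw [Function.update_of_ne h]; simp [vSt, h]
/-- Updating `fv2`. [folklore] -/
@[simp] theorem update_vSt_fv2 : Function.update (vSt S fv szs2 u1 u2 u3 fl2 fl3 fv2 fl ju) (kr KR.fv2) w = vSt S fv szs2 u1 u2 u3 fl2 fl3 w fl ju := by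
  funext r; by_cases h : r = kr KR.fv2
  · subst h; simp
  · rw [Function.update_of_ne h]; simp [vSt, h]
/-- Updating `fl`. [folklore] -/
@[simp] theorem update_vSt_fl : Function.update (vSt S fv szs2 u1 u2 u3 fl2 fl3 fv2 fl ju) (kr KR.fl) w = vSt S fv szs2 u1 u2 u3 fl2 fl3 fv2 w ju := by
  funext r; by_cases h : r = kr KR.fl
  · subst h; simp
  · rw [Function.update_of_ne h]; simp [vSt, h]
/-- Updating `ju`. [folklore] -/
@[simp] theorem update_vSt_ju : Function.update (vSt S fv szs2 u1 u2 u3 fl2 fl3 fv2 fl ju) (kr KR.ju) w = vSt S fv szs2 u1 u2 u3 fl2 fl3 fv2 fl w := by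
  funext r; by_cases h : r = kr KR.ju
  · subst h; simp
  · rw [Function.update_of_ne h]; simp [vSt, h]

end VstLemmas

/-- Every store is a `vSt` over itself. [folklore] -/
theorem vSt_eta (R : RStore) : vSt R (R (kr KR.fv)) (R (kr KR.szs2)) (R (kr KR.u1)) (R (kr KR.u2)) (R (kr KR.u3)) (R (kr KR.fl2)) (R (kr KR.fl3)) (R (kr KR.fv2)) (R (kr KR.fl)) (R (kr KR.ju)) = R := by
  funext r
  by_cases h0 : r = kr KR.fv; · subst h0; simp
  by_cases h1 : r = kr KR.szs2; · subst h1; simp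
  by_cases h2 : r = kr KR.u1; · subst h2; simp
  by_cases h3 : r = kr KR.u2; · subst h3; simp
  by_cases h4 : r = kr KR.u3; · subst h4; simp
  by_cases h5 : r = kr KR.fl2; · subst h5; simp
  by_cases h6 : r = kr KR.fl3; · subst h6; simp
  by_cases h7 : r = kr KR.fv2; · subst h7; simp
  by_cases h8 : r = kr KR.fl; · subst h8; simp
  by_cases h9 : r = kr KR.ju; · subst h9; simp
  rw [vSt_other _ _ _ _ _ _ _ _ _ _ _ h0 h1 h2 h3 h4 h5 h6 h7 h8 h9]

/-! ### The odometer step: specifications -/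

/-- The per-digit budget of the odometer. [folklore] -/
def fvK (m : ℕ) : ℕ := 33 * m + 32

section FvSpec

variable (S : RStore) (m : ℕ) (ht1 : S (kr KR.t1) = []) (ht2 : S (kr KR.t2) = [])
include ht1 ht2

/-- **One digit of the odometer.** Three outcomes: the digit was below its size (incremented,
stop), at its size with digits left (zeroed, continue), at its size and last (zeroed, wrapped).
[folklore] -/
theorem runs_fvBody (d s : ℕ) (hds : d ≤ s) (hsm : s ≤ m) (ds ss : List ℕ) (stg ju : List Γ') :
    Runs (fvBody m) (vSt S (dW (d :: ds)) (dW (s :: ss)) [] [] [] [] [] stg [] ju)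
      (if d < s then vSt S (dW ds) (dW ss) [] [] [] [] [] (Γ'.comma :: (List.replicate (d + 1) Γ'.blank ++ stg)) [] ju
       else if ds = [] then vSt S (dW ds) (dW ss) [] [] [] [] [] (Γ'.comma :: stg) [] (Γ'.blank :: ju)
       else vSt S (dW ds) (dW ss) [] [] [] [] [] (Γ'.comma :: stg) [Γ'.blank] ju) (fvK m) := by
  unfold fvBody
  -- 1./2. read the two digits
  have h1 := runs_readD (src := kr KR.fv) (dst := kr KR.u1) (by simp) m d (by omega) (dW ds) (vSt S (dW (d :: ds)) (dW (s :: ss)) [] [] [] [] [] stg [] ju)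
    (by rw [vSt_fv, dW_cons])
  rw [vSt_u1, List.append_nil, update_vSt_fv, update_vSt_u1] at h1
  have h2 := runs_readD (src := kr KR.szs2) (dst := kr KR.u2) (by simp) m s hsm (dW ss) (vSt S (dW ds) (dW (s :: ss)) (List.replicate d Γ'.blank) [] [] [] [] stg [] ju)
    (by rw [vSt_szs2, dW_cons])
  rw [vSt_u2, List.append_nil, update_vSt_szs2, update_vSt_u2] at h2
  -- 3. copy
  have h3 := runs_copyToG (a := kr KR.u1) (b := kr KR.u3) (t₁ := kr KR.t1) (t₂ := kr KR.t2)
    (by simp) (by simp) (by simp) (by simp) (by simp) (by simp) (vSt S (dW ds) (dW ss) (List.replicate d Γ'.blank) (List.replicate s Γ'.blank) [] [] [] stg [] ju)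
    (by simp [ht1]) (by simp [ht2]) (by simp)
  rw [vSt_u1, update_vSt_u3, List.length_replicate] at h3
  -- 4. compare
  set X3 := vSt S (dW ds) (dW ss) (List.replicate d Γ'.blank) (List.replicate s Γ'.blank) (List.replicate d Γ'.blank) [] [] stg [] ju with hX3
  have ecs : cmpSt (kr KR.u1) (kr KR.u2) (kr KR.fl2) Γ'.blank X3 d s False = X3 := by simp [cmpSt, flagW, hX3]
  have h4 := runs_cmpU (a := kr KR.u1) (b := kr KR.u2) (gt := kr KR.fl2) (lt := kr KR.fl3)
    (by simp) (by simp) (by simp) (by simp) (by simp) (by simp) Γ'.blank X3 d s False False (by simp [hX3, flagW])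
  rw [ecs] at h4
  have e4 : Function.update (cmpSt (kr KR.u1) (kr KR.u2) (kr KR.fl2) Γ'.blank X3 0 0 (False ∨ s < d)) (kr KR.fl3) (flagW Γ'.blank (False ∨ d < s)) =
      vSt S (dW ds) (dW ss) [] [] (List.replicate d Γ'.blank) [] (flagW Γ'.blank (d < s)) stg [] ju := by
    have hn : ¬ (s < d) := by omega
    simp only [cmpSt, hX3, List.replicate_zero, update_vSt_u1, update_vSt_u2, update_vSt_fl2, update_vSt_fl3, false_or, flagW_false _ hn]
  rw [e4] at h4
  -- 5. clear gt
  have h5 := runs_clear (kr KR.fl2) (vSt S (dW ds) (dW ss) [] [] (List.replicate d Γ'.blank) [] (flagW Γ'.blank (d < s)) stg [] ju)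
  rw [vSt_fl2, update_vSt_fl2, List.length_nil] at h5
  -- 6. branch
  have h6 : Runs (pop (kr KR.fl3) fun o => match o with
      | some _ => (loop (kr KR.u3) fun s => push (kr KR.fv2) s) ;; push (kr KR.fv2) Γ'.blank ;; push (kr KR.fv2) Γ'.comma
      | none => clear (kr KR.u3) ;; push (kr KR.fv2) Γ'.comma ;; ifTop (kr KR.fv) fun o' => match o' with
          | some _ => push (kr KR.fl) Γ'.blank
          | none => push (kr KR.ju) Γ'.blank)
      (vSt S (dW ds) (dW ss) [] [] (List.replicate d Γ'.blank) [] (flagW Γ'.blank (d < s)) stg [] ju)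
      (if d < s then vSt S (dW ds) (dW ss) [] [] [] [] [] (Γ'.comma :: (List.replicate (d + 1) Γ'.blank ++ stg)) [] ju
       else if ds = [] then vSt S (dW ds) (dW ss) [] [] [] [] [] (Γ'.comma :: stg) [] (Γ'.blank :: ju)
       else vSt S (dW ds) (dW ss) [] [] [] [] [] (Γ'.comma :: stg) [Γ'.blank] ju) (3 * d + 10) := by
    by_cases hlt : d < s
    · rw [if_pos hlt, flagW_true _ hlt]
      refine (Runs.pop_cons (k := kr KR.fl3) (a := Γ'.blank) (w := []) (by simp) ?_).mono (show ((3 * d + 1) + 1 + 1) + 2 ≤ _ by omega)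
      rw [update_vSt_fl3]
      have hm := runs_moveAll (a := kr KR.u3) (b := kr KR.fv2) (by simp) (List.replicate d Γ'.blank) (vSt S (dW ds) (dW ss) [] [] (List.replicate d Γ'.blank) [] [] stg [] ju) (by simp)
      rw [vSt_fv2, update_vSt_u3, update_vSt_fv2, List.reverse_replicate, List.length_replicate] at hm
      refine hm.seq ((Runs.push' (R' := vSt S (dW ds) (dW ss) [] [] [] [] [] (Γ'.blank :: (List.replicate d Γ'.blank ++ stg)) [] ju) (by simp)).seq (Runs.push' ?_))
      rw [vSt_fv2, update_vSt_fv2, List.replicate_succ, List.cons_append]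
    · rw [if_neg hlt, flagW_false _ hlt]
      refine (Runs.pop_nil (by simp) ?_).mono (show ((2 * d + 1) + (1 + 4)) + 2 ≤ _ by omega)
      dsimp only
      have hc := runs_clear (kr KR.u3) (vSt S (dW ds) (dW ss) [] [] (List.replicate d Γ'.blank) [] [] stg [] ju)
      rw [vSt_u3, update_vSt_u3, List.length_replicate] at hc
      have hp : Runs (push (kr KR.fv2) Γ'.comma) (vSt S (dW ds) (dW ss) [] [] [] [] [] stg [] ju) (vSt S (dW ds) (dW ss) [] [] [] [] [] (Γ'.comma :: stg) [] ju) 1 :=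
        Runs.push' (by simp)
      have hi : Runs (ifTop (kr KR.fv) fun o' => match o' with
          | some _ => push (kr KR.fl) Γ'.blank
          | none => push (kr KR.ju) Γ'.blank) (vSt S (dW ds) (dW ss) [] [] [] [] [] (Γ'.comma :: stg) [] ju)
          (if ds = [] then vSt S (dW ds) (dW ss) [] [] [] [] [] (Γ'.comma :: stg) [] (Γ'.blank :: ju)
           else vSt S (dW ds) (dW ss) [] [] [] [] [] (Γ'.comma :: stg) [Γ'.blank] ju) 4 := by
        by_cases hds0 : ds = []
        · rw [if_pos hds0]; subst hds0
          exact (Runs.ifTop_nil (R := vSt S (dW []) (dW ss) [] [] [] [] [] (Γ'.comma :: stg) [] ju) (by simp) (Runs.push' (by simp))).mono (by norm_num)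
        · rw [if_neg hds0]
          obtain ⟨d', ds', rfl⟩ := List.exists_cons_of_ne_nil hds0
          cases d' with
          | zero =>
            exact Runs.ifTop_cons (R := vSt S (dW (0 :: ds')) (dW ss) [] [] [] [] [] (Γ'.comma :: stg) [] ju) (x := Γ'.comma) (w := dW ds')
              (by simp [dW_cons]) (Runs.push' (by simp))
          | succ d' =>
            exact Runs.ifTop_cons (R := vSt S (dW ((d' + 1) :: ds')) (dW ss) [] [] [] [] [] (Γ'.comma :: stg) [] ju) (x := Γ'.blank)
              (w := List.replicate d' Γ'.blank ++ Γ'.comma :: dW ds') (by simp [dW_cons, List.replicate_succ]) (Runs.push' (by simp))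
      exact hc.seq (hp.seq hi)
  refine (h1.seq (h2.seq (h3.seq (h4.seq (h5.seq h6))))).mono ?_
  unfold fvK; omega

end FvSpec

/-! ### The odometer step: the loop and the whole step -/

/-- The registers `(fv, szs2, fv2, wrapped)` after the digit loop started with staging `stg`.
[folklore] -/
def loopSt : List ℕ → List ℕ → List Γ' → List Γ' × List Γ' × List Γ' × Bool
  | d :: ds, s :: ss, stg =>
    if d < s then (dW ds, dW ss, Γ'.comma :: (List.replicate (d + 1) Γ'.blank ++ stg), false)
    else if ds = [] then ([], dW ss, Γ'.comma :: stg, true)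
    else loopSt ds ss (Γ'.comma :: stg)
  | _, _, stg => ([], [], stg, true)

section FvLoop

variable (S : RStore) (m : ℕ) (ht1 : S (kr KR.t1) = []) (ht2 : S (kr KR.t2) = [])
include ht1 ht2

/-- **The digit loop.** [folklore] -/
theorem runs_fvLoop : ∀ (ds ss : List ℕ), List.Forall₂ (· ≤ ·) ds ss → (∀ s ∈ ss, s ≤ m) → ds ≠ [] → ∀ (stg ju : List Γ'),
    Runs (whileLoop (kr KR.fl) (fvBody m)) (vSt S (dW ds) (dW ss) [] [] [] [] [] stg [Γ'.blank] ju)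
      (vSt S (loopSt ds ss stg).1 (loopSt ds ss stg).2.1 [] [] [] [] [] (loopSt ds ss stg).2.2.1 []
        (if (loopSt ds ss stg).2.2.2 then Γ'.blank :: ju else ju))
      ((fvK m + 2) * ds.length + 1)
  | [], _, _, _, hne, _, _ => absurd rfl hne
  | d :: ds, [], hF, _, _, _, _ => by cases hF
  | d :: ds, s :: ss, hF, hss, _, stg, ju => by
    obtain ⟨hds, hF'⟩ : d ≤ s ∧ List.Forall₂ (· ≤ ·) ds ss := by cases hF with | cons h t => exact ⟨h, t⟩
    have hsm : s ≤ m := hss s (by simp)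
    have hss' : ∀ s' ∈ ss, s' ≤ m := fun s' h => hss s' (by simp [h])
    unfold whileLoop
    have hk : vSt S (dW (d :: ds)) (dW (s :: ss)) [] [] [] [] [] stg [Γ'.blank] ju (kr KR.fl) = Γ'.blank :: [] := by simp
    have hb := runs_fvBody S m ht1 ht2 d s hds hsm ds ss stg ju
    have hb' : Runs (fvBody m) (Function.update (vSt S (dW (d :: ds)) (dW (s :: ss)) [] [] [] [] [] stg [Γ'.blank] ju) (kr KR.fl) [])
        (if d < s then vSt S (dW ds) (dW ss) [] [] [] [] [] (Γ'.comma :: (List.replicate (d + 1) Γ'.blank ++ stg)) [] ju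
         else if ds = [] then vSt S (dW ds) (dW ss) [] [] [] [] [] (Γ'.comma :: stg) [] (Γ'.blank :: ju)
         else vSt S (dW ds) (dW ss) [] [] [] [] [] (Γ'.comma :: stg) [Γ'.blank] ju) (fvK m) := by
      rw [update_vSt_fl]; exact hb
    rw [loopSt]
    by_cases hlt : d < s
    · rw [if_pos hlt] at hb' ⊢
      have hrest := Runs.loop_nil (k := kr KR.fl) (fun _ => fvBody m) (R := vSt S (dW ds) (dW ss) [] [] [] [] [] (Γ'.comma :: (List.replicate (d + 1) Γ'.blank ++ stg)) [] ju) (by simp)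
      refine (Runs.loop_cons (f := fun _ => fvBody m) hk hb' hrest).of_eq (by simp) ?_
      simp only [List.length_cons]; nlinarith
    · rw [if_neg hlt] at hb' ⊢
      by_cases hds0 : ds = []
      · rw [if_pos hds0] at hb' ⊢
        have hrest := Runs.loop_nil (k := kr KR.fl) (fun _ => fvBody m) (R := vSt S (dW ds) (dW ss) [] [] [] [] [] (Γ'.comma :: stg) [] (Γ'.blank :: ju)) (by simp)
        refine (Runs.loop_cons (f := fun _ => fvBody m) hk hb' hrest).of_eq ?_ ?_
        · subst hds0; simp
        · simp only [List.length_cons]; nlinarith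
      · rw [if_neg hds0] at hb' ⊢
        have ih := runs_fvLoop ds ss hF' hss' hds0 (Γ'.comma :: stg) ju
        unfold whileLoop at ih
        refine (Runs.loop_cons (f := fun _ => fvBody m) hk hb' ih).of_eq rfl ?_
        simp only [List.length_cons]; nlinarith

omit ht1 ht2 in
/-- **What the digit loop computes**: the staged digits reversed, then the untouched ones, are
the incremented vector; the flag is the overflow. [folklore] -/
theorem loopSt_spec : ∀ (ds ss : List ℕ), List.Forall₂ (· ≤ ·) ds ss → ds ≠ [] → ∀ (stg : List Γ'),
    (loopSt ds ss stg).2.2.1.reverse ++ (loopSt ds ss stg).1 = stg.reverse ++ dW (succD ds ss).1 ∧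
    (loopSt ds ss stg).2.2.2 = (succD ds ss).2 ∧ (loopSt ds ss stg).2.1.length ≤ (dW ss).length ∧
    (loopSt ds ss stg).2.2.1.length ≤ stg.length + (dW ds).length + 1
  | [], _, _, hne, _ => absurd rfl hne
  | d :: ds, [], hF, _, _ => by cases hF
  | d :: ds, s :: ss, hF, _, stg => by
    obtain ⟨hds, hF'⟩ : d ≤ s ∧ List.Forall₂ (· ≤ ·) ds ss := by cases hF with | cons h t => exact ⟨h, t⟩
    rw [loopSt, succD]
    by_cases hlt : d < s
    · rw [if_pos hlt, if_pos hlt]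
      refine ⟨by simp [dW_cons, List.reverse_append], rfl, by dsimp only; rw [length_dW_cons]; omega, ?_⟩
      simp only [List.length_cons, List.length_append, List.length_replicate, dW_cons]; omega
    · rw [if_neg hlt, if_neg hlt]
      by_cases hds0 : ds = []
      · rw [if_pos hds0]
        subst hds0
        cases hF'
        refine ⟨by simp [succD, dW], by simp [succD], by dsimp only; rw [length_dW_cons]; omega, by simp⟩
      · rw [if_neg hds0]
        obtain ⟨h1, h2, h3, h4⟩ := loopSt_spec ds ss hF' hds0 (Γ'.comma :: stg)
        refine ⟨?_, h2, h3.trans (by rw [length_dW_cons]; omega), ?_⟩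
        · rw [h1]; simp [dW_cons]
        · simp only [List.length_cons, dW_cons, List.length_append, List.length_replicate] at h4 ⊢; omega

/-- The cost of `fvStep`. [folklore] -/
def fvStepCost (m q : ℕ) : ℕ := 4 + (10 * ((m + 1) * q) + 3) + 1 + ((fvK m + 2) * q + 1) + (3 * ((m + 1) * q + 1) + 1) + (2 * ((m + 1) * q) + 1)

omit ht1 ht2 in
/-- A digit word of digits bounded by `m` is at most `(m + 1) |ds|` long. [folklore] -/
theorem length_dW_le (ds : List ℕ) (h : ∀ d ∈ ds, d ≤ m) : (dW ds).length ≤ (m + 1) * ds.length := by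
  unfold dW; rw [List.length_flatMap]
  calc (ds.map fun d => (List.replicate d Γ'.blank ++ [Γ'.comma]).length).sum ≤ (ds.map fun _ => m + 1).sum :=
        List.sum_le_sum (fun d hd => by simp; exact h d hd)
    _ = (m + 1) * ds.length := by rw [List.map_const', List.sum_replicate, smul_eq_mul, Nat.mul_comm]

/-- **Specification of `fvStep`.** [folklore] -/
theorem runs_fvStep (ds ss : List ℕ) (hF : List.Forall₂ (· ≤ ·) ds ss) (hss : ∀ s ∈ ss, s ≤ m)
    (hszs : S (kr KR.szs) = dW ss) (hfv : S (kr KR.fv) = dW ds) (hszs2 : S (kr KR.szs2) = []) (hu1 : S (kr KR.u1) = []) (hu2 : S (kr KR.u2) = [])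
    (hu3 : S (kr KR.u3) = []) (hfl2 : S (kr KR.fl2) = []) (hfl3 : S (kr KR.fl3) = []) (hfv2 : S (kr KR.fv2) = []) (hfl : S (kr KR.fl) = [])
    (hju : S (kr KR.ju) = []) :
    Runs (fvStep m) S (Function.update (Function.update S (kr KR.fv) (dW (succD ds ss).1)) (kr KR.ju) (uflag (succD ds ss).2)) (fvStepCost m ds.length) := by
  have e0 : vSt S (dW ds) (dW ss) [] [] [] [] [] [] [] [] = Function.update S (kr KR.szs2) (dW ss) := by
    have e := vSt_eta (Function.update S (kr KR.szs2) (dW ss))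
    simp only [ne_eq, reduceCtorEq, not_false_eq_true, Function.update_of_ne, Sum.inr.injEq, hfv, Function.update_self, hu1, hu2, hu3, hfl2, hfl3, hfv2, hfl, hju] at e
    rw [← e]
    funext r
    by_cases h : r = kr KR.szs2
    · subst h; simp
    · rw [vSt, vSt]; simp only [h, if_false]; rw [Function.update_of_ne h]
  have hds_le : ∀ d ∈ ds, d ≤ m := fun d hd => by
    obtain ⟨i, hi, rfl⟩ := List.getElem_of_mem hd
    have h2 := List.Forall₂.get hF hi (by rw [← hF.length_eq]; exact hi)
    exact h2.trans (hss _ (List.getElem_mem _))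
  unfold fvStep
  by_cases hds0 : ds = []
  · subst hds0
    cases hF
    have : Runs (push (kr KR.ju) Γ'.blank) S (Function.update (Function.update S (kr KR.fv) (dW (succD [] []).1)) (kr KR.ju) (uflag (succD [] []).2)) 1 := by
      refine Runs.push' ?_
      have hs0 : succD [] [] = ([], true) := rfl
      rw [hju, hs0]; simp only [dW_nil, uflag_true]
      have e : Function.update S (kr KR.fv) (dW []) = S := Function.update_eq_self_iff.2 hfv.symm
      rw [dW_nil] at e
      rw [e]
    exact (Runs.ifTop_nil (by rw [hfv]; rfl) this).mono (by unfold fvStepCost; omega)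
  · -- the first symbol of `fv`
    obtain ⟨d, ds', rfl⟩ := List.exists_cons_of_ne_nil hds0
    have hinner : Runs (copyToG (kr KR.szs) (kr KR.szs2) (kr KR.t1) (kr KR.t2) ;; push (kr KR.fl) Γ'.blank ;; whileLoop (kr KR.fl) (fvBody m) ;;
        pour (kr KR.fv2) (kr KR.fv) ;; clear (kr KR.szs2)) S
        (Function.update (Function.update S (kr KR.fv) (dW (succD (d :: ds') ss).1)) (kr KR.ju) (uflag (succD (d :: ds') ss).2))
        ((10 * (dW ss).length + 3) + 1 + ((fvK m + 2) * (d :: ds').length + 1) + (3 * ((loopSt (d :: ds') ss []).2.2.1).length + 1) +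
          (2 * ((loopSt (d :: ds') ss []).2.1).length + 1)) := by
      have h1 := runs_copyToG (a := kr KR.szs) (b := kr KR.szs2) (t₁ := kr KR.t1) (t₂ := kr KR.t2)
        (by simp) (by simp) (by simp) (by simp) (by simp) (by simp) S ht1 ht2 hszs2
      rw [hszs, ← e0] at h1
      have h2 : Runs (push (kr KR.fl) Γ'.blank) (vSt S (dW (d :: ds')) (dW ss) [] [] [] [] [] [] [] []) (vSt S (dW (d :: ds')) (dW ss) [] [] [] [] [] [] [Γ'.blank] []) 1 :=
        Runs.push' (by simp)
      have h3 := runs_fvLoop S m ht1 ht2 (d :: ds') ss hF hss (List.cons_ne_nil _ _) [] []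
      obtain ⟨q1, q2, q3, q4⟩ := loopSt_spec (d :: ds') ss hF (List.cons_ne_nil _ _) []
      set L := loopSt (d :: ds') ss [] with hL
      have h4 := runs_pour (a := kr KR.fv2) (b := kr KR.fv) (by simp) (vSt S L.1 L.2.1 [] [] [] [] [] L.2.2.1 [] (if L.2.2.2 then [Γ'.blank] else []))
      rw [vSt_fv2, vSt_fv, update_vSt_fv2, update_vSt_fv, q1, List.reverse_nil, List.nil_append] at h4
      have h5 := runs_clear (kr KR.szs2) (vSt S (dW (succD (d :: ds') ss).1) L.2.1 [] [] [] [] [] [] [] (if L.2.2.2 then [Γ'.blank] else []))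
      rw [vSt_szs2, update_vSt_szs2] at h5
      refine (h1.seq (h2.seq (h3.seq (h4.seq h5)))).of_eq ?_ (by omega)
      rw [q2]
      funext r
      by_cases r1 : r = kr KR.ju
      · subst r1; cases (succD (d :: ds') ss).2 <;> simp
      rw [Function.update_of_ne r1]
      by_cases r2 : r = kr KR.fv
      · subst r2; simp
      rw [Function.update_of_ne r2]
      by_cases g1 : r = kr KR.szs2; · subst g1; simp [hszs2]
      by_cases g2 : r = kr KR.u1; · subst g2; simp [hu1]
      by_cases g3 : r = kr KR.u2; · subst g3; simp [hu2]
      by_cases g4 : r = kr KR.u3; · subst g4; simp [hu3]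
      by_cases g5 : r = kr KR.fl2; · subst g5; simp [hfl2]
      by_cases g6 : r = kr KR.fl3; · subst g6; simp [hfl3]
      by_cases g7 : r = kr KR.fv2; · subst g7; simp [hfv2]
      by_cases g8 : r = kr KR.fl; · subst g8; simp [hfl]
      rw [vSt_other _ _ _ _ _ _ _ _ _ _ _ r2 g1 g2 g3 g4 g5 g6 g7 g8 r1]
    have hk : S (kr KR.fv) = (if d = 0 then Γ'.comma else Γ'.blank) :: (dW (d :: ds')).tail := by
      rw [hfv, dW_cons]; cases d <;> simp [List.replicate_succ]
    refine (Runs.ifTop_cons hk hinner).mono ?_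
    obtain ⟨-, -, q3, q4⟩ := loopSt_spec (d :: ds') ss hF (List.cons_ne_nil _ _) []
    have hl1 := length_dW_le m ss hss
    have hl2 := length_dW_le m (d :: ds') hds_le
    have hlen : ss.length = (d :: ds').length := hF.length_eq.symm
    rw [hlen] at hl1
    simp only [List.length_nil, Nat.zero_add] at q4
    unfold fvStepCost
    have : (fvK m + 2) * (d :: ds').length = (fvK m + 2) * (d :: ds').length := rfl
    nlinarith [q3, q4, hl1, hl2]

end FvLoop

end Literature.Computability.FineGrained.IPRenameM
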